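import Literature.NumberTheory.GaloisRepresentations.ArtinLFunction
import Mathlib.Analysis.Meromorphic.Order
import Mathlib.RepresentationTheory.Intertwining
import Mathlib.LinearAlgebra.Eigenspace.Basic
import Mathlib.LinearAlgebra.Matrix.Determinant.Basic
import Mathlib.Algebra.Module.LinearMap.Star
import HarnessLib

/-!
# Barrier: no Weil cohomology with real coefficients for arithmetic curves (Deninger 2022)

Barrier catalogue `Literature/Barriers/RiemannHypothesis/` (D-0021), entry `NoRealWeilCohomology`
(namespace `Literature.Barriers.RiemannHypothesis`; catalogued declaration
`Deninger2022_noRealWeilCohomology`, with the *mechanism* — Frobenius–Schur parity — proved in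
full: `finrank_even_of_quaternionicStructure`, `finrank_intertwiningMap_even`,
`not_satisfiesCentralMultiplicity_of_oddCentralOrder`).

## The technique (Deninger, *There is no Weil-cohomology theory with real coefficients for
## arithmetic curves*, §2)

A conjectural cohomology theory `H•(Spec ō_k, 𝒞)` for arithmetic curves `Spec ō_k` (the
arithmetic compactification of the spectrum of the integers of a number field `k`) with values in
`ℂ`-vector spaces and a functorial endomorphism `θ`, whose eigenvalues on `H¹` are the non-trivial
zeros of `ζ_k` ((2.1)–(2.8) of the paper).  For `k/ℚ` Galois with group `G`, functoriality makes
`G` act on `H¹` commuting with `θ`, and in accordance with `ζ_k(s) = ∏_π L(V_π, s)^{dim V_π}` one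
expects, for every irreducible complex representation `π` of `G` and `α ∈ ℂ` ((2.10), (2.11)),
`dim_ℂ Hom_G(V_π, H¹(Spec ō_k, 𝒞)^{θ∼α}) = ord_{s=α} L(V_π, s)`; at `α = 1/2`, with
`V_k := H¹(Spec ō_k, 𝒞)^{θ∼1/2}` (finite-dimensional by (2.8)):

* **(2.12)** `dim_ℂ Hom_G(V_π, V_k) = ord_{s=1/2} L(V_π, s)`.

A theory *with real coefficients* is one of the form `H•(–, 𝒞) = H•(–, ℛ) ⊗_ℝ ℂ`, `θ = θ_ℝ ⊗ id`;
then `V_k = V_k^ℝ ⊗_ℝ ℂ` with `V_k^ℝ := H¹(Spec ō_k, ℛ)^{θ_ℝ∼1/2}` a real `G`-module (proof of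
Thm. 2.13), i.e. `V_k` is a complex `G`-module carrying a `G`-invariant **real structure**
(an antilinear involution `σ = id ⊗ conj` commuting with `G`).

* **Theorem 2.13** (verbatim). *For a number field `k` there is no functorial real valued
  cohomology theory `H•(Spec ō_k, ℛ)` with endomorphism `θ_ℝ` such that
  `H•(Spec ō_k, 𝒞) := H•(Spec ō_k, ℛ) ⊗_ℝ ℂ` with `θ := θ_ℝ ⊗ id` satisfies property (2.12).*

Printed proof (p. 4, 12 lines): take `k/ℚ` Galois whose group `G` has an irreducible
**symplectic** (quaternionic-type) representation `V_π` with Artin root number `W(π) = −1` —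
"there exist quaternion fields i.e. normal extensions of `ℚ` with Galois group the quaternion group
`H₈` with 8 elements whose Artin L-function for the unique non-abelian representation (it is
symplectic) has root number `−1`. See [O] for examples of such fields" — so that, by the functional
equation, `ord_{s=1/2} L(V_π, s) ≥ 1` is **odd**; by (2.12) `V_π` occurs in `V_k = V_k^ℝ ⊗ ℂ`
with odd multiplicity; but by Serre's trichotomy of real irreducibles [S1] (`Res V` of a
non-self-dual `V` complexifies to `V ⊕ V̄`, an orthogonal `W` stays irreducible orthogonal, a
symplectic `W = Res V` complexifies to `V ⊕ V`) a symplectic irreducible occurs in the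
complexification of a real `G`-module with **even** multiplicity — contradiction.

## What this file vendors

* **The mechanism, proved** (no arithmetic input; replaces the appeal to [S1] by the equivalent
  direct argument "`Hom_G(V_π, V_k)` inherits a quaternionic structure `f ↦ σ ∘ f ∘ J`"):
  `finrank_even_of_quaternionicStructure` — a finite-dimensional `ℂ`-space with an antilinear `J`,
  `J² = −1`, has even dimension (also the remark before (2.9): a quaternionic structure on `V_k`
  forces `dim V_k` even); `finrank_intertwiningMap_even` — for any monoid `G`, a complex
  `G`-module `E` with a `G`-invariant real structure `σ` and a `G`-module `W` with a `G`-invariant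
  quaternionic structure `J`, `dim_ℂ Hom_G(W, E)` is even; `maxGenEigenspace_realStructure_stable`
  — the generalized eigenspaces of an equivariant `θ` commuting with `σ` at **real** `α` are
  `σ`-stable (so `V_k` inherits the real structure of `H¹`, as used in the proof of Thm. 2.13).
* **The arithmetic vocabulary** in the tree's language: a finite Galois `k/ℚ` is presented by
  its group `G = Gal(k/ℚ)` (finite, discrete) with the restriction `r : Γ_ℚ ↠ G`, a continuous
  surjection from `Γ_ℚ = Field.absoluteGaloisGroup ℚ` (`IsFiniteGaloisQuotient`; by infinite
  Galois theory these are exactly the finite Galois subextensions of `ℚ̄/ℚ`, cf.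
  `Literature.NumberTheory.GaloisRepresentations.absRestrictNormalHom`); `π : G →* GL_n(ℂ)` with
  `V_π = ℂⁿ` (`matrixRep π`, via
  `Literature.NumberTheory.GaloisRepresentations.glStdRepresentation`),
  its inflation `inflate r π = π ∘ r : Γ_ℚ →ₜ* GL_n(ℂ)` (a `FramedArtinRep ℚ n`, cf.
  `inflateCharacter`), the Artin L-function
  `Literature.NumberTheory.GaloisRepresentations.artinLFunction (inflate r π).toArtinRep`
  (Euler product, genuine for `re s > 1`) and "`ord_{s=1/2} L(V_π, s) = m`" rendered as
  `meromorphicOrderAt g (1/2) = m` for a function `g` meromorphic on `ℂ` agreeing with the Euler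
  product on `re s > 1` (`IsArtinContinuation`; such `g` exist by Brauer's theorem,
  `Literature.NumberTheory.Automorphic.artin_brauer_hasMeromorphicContinuation`, and all have the
  same order at `1/2` by the identity principle; property (2.12) is rendered with `∃ g`, the
  oddness input `HasOddCentralOrder` with `∀ g`, so that no uniqueness statement is needed).
* **Property (2.12)** for a complex `G`-module `(E, ρ)` in the role of `V_k`:
  `SatisfiesCentralMultiplicity r ρ`; **real structure**: `IsRealStructure ρ σ`.
* **The reduction, proved**: `not_satisfiesCentralMultiplicity_of_oddCentralOrder` — if `G` has an
  irreducible `π` of quaternionic type all of whose meromorphic continuations of `L(V_π, s)` have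
  odd order at `s = 1/2`, then no complex `G`-module with a `G`-invariant real structure satisfies
  (2.12) over that `k`.
* **The barrier, a named fact** (D-0014/D-0026: the one new `def … : Prop` of this file):
  `Deninger2022_noRealWeilCohomology` — Theorem 2.13 as printed, in the form the printed proof
  establishes: there is a finite Galois `k/ℚ` over which no complex `Gal(k/ℚ)`-module with an
  invariant real structure satisfies (2.12).  What separates it from the proved reduction is the
  arithmetic input of the printed proof, not vendored here as a separate fact: the existence of a
  Galois `k/ℚ` with an irreducible symplectic `π` of root number `W(π) = −1` (Deninger's [O] =
  [cite: Omar2001]; [cite: Frohlich1972]) and the functional equation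
  `Λ(V_π, 1 − s) = W(π) Λ(V_π, s)` for self-dual `π`
  (`Literature.NumberTheory.GaloisRepresentations.ArtinRep.SatisfiesFunctionalEquation`), which
  together give an odd `ord_{s=1/2} L(V_π, s)`.  The functorial formulation ("no functor
  `k ↦ (H•(Spec ō_k, ℛ), θ_ℝ)`") follows at once, since such a functor restricted to the witness
  `k` is a real-structured `Gal(k/ℚ)`-module satisfying (2.12): `noFunctorialRealTheory`.
* `SatisfiesCentralMultiplicity r ρ` is stated for `(E, ρ)` = the `1/2`-part itself; for a theory
  given as `(H¹, θ)` one takes `E = (H¹)^{θ∼1/2}` with the restricted action and real structure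
  (`maxGenEigenspace_realStructure_stable`), exactly as in the printed proof.

Not vendored: the function-field analogue of (2.10) ("true, c.f. [FQ]"), Serre's classical remark
that no real (or `ℚ_p`) Weil cohomology exists for varieties over `𝔽̄_p` (§1 of the paper:
supersingular `E`, `End(E) ⊗ ℝ = ℍ` does not act on a 2-dimensional real space), the "Vanishing
Conjecture" and the conjectural description (2.14)–(2.15) of `V_k`.

## References

* [Deninger2022] C. Deninger, *There is no Weil-cohomology theory with real coefficients for
  arithmetic curves*, Ann. Sc. Norm. Super. Pisa Cl. Sci. (to appear), arXiv:2204.02714 (read: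
  §2, (2.1)–(2.15), Theorem 2.13 and its proof, pp. 3–5 of the arXiv version).
* [Omar2001] S. Omar, *On Artin L-functions for octic quaternion fields*, Experiment. Math. 10
  (2001), 237–245, doi:10.1080/10586458.2001.10504445 (= ref. [O] of [Deninger2022]: quaternion
  fields with `W(π) = −1`, numerical verification of the vanishing conjecture).
* [Frohlich1972] A. Fröhlich, *Artin-root numbers and normal integral bases for quaternion
  fields*, Invent. Math. 17 (1972), 143–166, doi:10.1007/bf01418937 (existence of `H₈`-fields
  whose symplectic character has root number `W = −1`).
* [S1] J.-P. Serre, *Linear representations of finite groups*, GTM 42, §13.2 (the three types of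
  irreducible representations over `ℝ`; cited through [Deninger2022], ref. [S1]).
* [Sch] P. Scholze, *p-adic geometry*, Proc. ICM 2018 (ref. [Sch] of [Deninger2022]): Weil
  cohomology with values in Kottwitz's category `Kt_ℚ` / `K_ℝ` — the quaternionic evasion (p. 2 and
  p. 5 of the arXiv version of [Deninger2022]).
* [FQ] A. Fröhlich, J. Queyrut, *On the functional equation of the Artin L-function for characters
  of real representations*, Invent. Math. 20 (1973), 125–138 (ref. [FQ] of [Deninger2022]:
  orthogonal `π` have `W(π) = +1`; the function-field analogue of (2.10)).
-/

noncomputable section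

open scoped ComplexConjugate
open Module Complex Representation
open Literature.NumberTheory.GaloisRepresentations

namespace Literature.Barriers.RiemannHypothesis

universe u v w

/-! ## §1. Quaternionic structures force even dimension -/

section Quaternionic

variable {V : Type u} [AddCommGroup V] [Module ℂ V] [FiniteDimensional ℂ V]

/-- The coordinate matrix of an antilinear map `J` in a basis `b`: column `j` holds the
coordinates of `J (b j)`. [folklore] -/
def antilinearMatrix {ι : Type*} [Fintype ι] (b : Basis ι ℂ V) (J : V →ₗ⋆[ℂ] V) :
    Matrix ι ι ℂ :=
  fun i j => b.repr (J (b j)) i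

omit [FiniteDimensional ℂ V] in
/-- `J (b j) = ∑ i, A i j • b i` for the coordinate matrix `A`. [folklore] -/
private theorem antilinearMatrix_sum {ι : Type*} [Fintype ι] (b : Basis ι ℂ V) (J : V →ₗ⋆[ℂ] V)
    (j : ι) : ∑ i, antilinearMatrix b J i j • b i = J (b j) :=
  b.sum_repr (J (b j))

omit [FiniteDimensional ℂ V] in
/-- If `J` is antilinear with coordinate matrix `A`, then `J ∘ J` has coordinate matrix `A · Ā`:
`b.repr (J (J (b j))) i = (A * A.map conj) i j`. [folklore] -/
private theorem repr_comp_antilinear {ι : Type*} [Fintype ι] (b : Basis ι ℂ V) (J : V →ₗ⋆[ℂ] V)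
    (i j : ι) :
    b.repr (J (J (b j))) i =
      (antilinearMatrix b J * (antilinearMatrix b J).map (starRingEnd ℂ)) i j := by
  classical
  have h1 : J (J (b j)) = ∑ l, (starRingEnd ℂ) (antilinearMatrix b J l j) • J (b l) := by
    conv_lhs => rw [← antilinearMatrix_sum b J j]
    rw [map_sum]
    refine Finset.sum_congr rfl fun l _ => ?_
    rw [LinearMap.map_smulₛₗ]
  have h2 : ∀ l, J (b l) = ∑ m, antilinearMatrix b J m l • b m :=
    fun l => (antilinearMatrix_sum b J l).symm
  rw [h1]
  simp only [map_sum, map_smul, Finsupp.coe_finsetSum, Finsupp.coe_smul, Finset.sum_apply,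
    Pi.smul_apply, smul_eq_mul, Matrix.mul_apply, Matrix.map_apply]
  refine Finset.sum_congr rfl fun l _ => ?_
  rw [mul_comm]
  rfl

/-- **A quaternionic structure forces even dimension.**  If a finite-dimensional complex vector
space `V` carries an antilinear map `J` with `J ∘ J = −id` (a quaternionic structure), then
`dim_ℂ V` is even.  Proof: in a basis, `J` has a coordinate matrix `A` with `A Ā = −1`, so
`|det A|² = det(−1) = (−1)^{dim V}`.  (Deninger 2022, remark before (2.9): "`V_k` carries a
quaternionic structure and hence it has even `ℂ`-dimension".)
[cite: Deninger2022, §2, remark before (2.9)] -/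
theorem finrank_even_of_quaternionicStructure (J : V →ₗ⋆[ℂ] V) (hJ : ∀ v, J (J v) = -v) :
    Even (finrank ℂ V) := by
  classical
  set d := finrank ℂ V with hd
  let b : Basis (Fin d) ℂ V := Module.finBasis ℂ V
  set A : Matrix (Fin d) (Fin d) ℂ := antilinearMatrix b J with hA
  -- `A * Ā = -1`
  have hAA : A * A.map (starRingEnd ℂ) = -1 := by
    ext i j
    rw [← repr_comp_antilinear b J i j, hJ, map_neg, Matrix.neg_apply, Matrix.one_apply,
      Basis.repr_self, Finsupp.neg_apply, Finsupp.single_apply]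
    simp only [eq_comm]
  -- determinants: `det A * conj (det A) = (-1)^d`
  have hdet : A.det * (starRingEnd ℂ) A.det = (-1) ^ d := by
    rw [RingHom.map_det, RingHom.mapMatrix_apply, ← Matrix.det_mul, hAA, Matrix.det_neg,
      Matrix.det_one, mul_one, Fintype.card_fin]
  rw [Complex.mul_conj] at hdet
  by_contra hodd
  rw [Nat.not_even_iff_odd] at hodd
  rw [hodd.neg_one_pow] at hdet
  have hre := congrArg Complex.re hdet
  simp only [Complex.ofReal_re, Complex.neg_re, Complex.one_re] at hre
  have := Complex.normSq_nonneg A.det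
  linarith

end Quaternionic

/-! ## §2. Group modules with real and quaternionic structures: `dim Hom_G(W, E)` is even -/

section Intertwining

variable {G : Type u} [Monoid G] {W : Type v} {E : Type w} [AddCommGroup W] [Module ℂ W]
  [AddCommGroup E] [Module ℂ E]

/-- A `G`-invariant **real structure** on a complex `G`-module `(E, ρ)`: an antilinear `σ` with
`σ ∘ σ = id` commuting with every `ρ g` (so that `E = E^σ ⊗_ℝ ℂ` with `E^σ` a real `G`-module —
Deninger's `V_k = V_k^ℝ ⊗_ℝ ℂ`). [cite: Deninger2022, §2, proof of Thm. 2.13] -/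
def IsRealStructure (ρ : Representation ℂ G E) (σ : E →ₗ⋆[ℂ] E) : Prop :=
  (∀ x, σ (σ x) = x) ∧ ∀ g x, σ (ρ g x) = ρ g (σ x)

/-- A `G`-invariant **quaternionic structure** on a complex `G`-module `(W, π)`: an antilinear `J`
with `J ∘ J = −id` commuting with every `π g`.  An irreducible `π` admitting one is *symplectic*
(quaternionic type, Frobenius–Schur indicator `−1`) in the sense of [S1].
[cite: Deninger2022, §2, (2.7) and proof of Thm. 2.13] -/
def IsQuaternionicStructure (π : Representation ℂ G W) (J : W →ₗ⋆[ℂ] W) : Prop :=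
  (∀ w, J (J w) = -w) ∧ ∀ g w, J (π g w) = π g (J w)

/-- For antilinear `σ` on `E` and `J` on `W`, the map `f ↦ σ ∘ f ∘ J` sends `ℂ`-linear maps
`W → E` to `ℂ`-linear maps. [folklore] -/
def conjTwistLinear (σ : E →ₗ⋆[ℂ] E) (J : W →ₗ⋆[ℂ] W) (f : W →ₗ[ℂ] E) : W →ₗ[ℂ] E where
  toFun w := σ (f (J w))
  map_add' x y := by rw [map_add, map_add, map_add]
  map_smul' c x := by
    rw [LinearMap.map_smulₛₗ, map_smul, LinearMap.map_smulₛₗ, RingHom.id_apply,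
      starRingEnd_self_apply]

/-- Unfolding lemma for `conjTwistLinear`. [folklore] -/
@[simp] private theorem conjTwistLinear_apply (σ : E →ₗ⋆[ℂ] E) (J : W →ₗ⋆[ℂ] W) (f : W →ₗ[ℂ] E)
    (w : W) : conjTwistLinear σ J f w = σ (f (J w)) := rfl

variable {π : Representation ℂ G W} {ρ : Representation ℂ G E} {σ : E →ₗ⋆[ℂ] E}
  {J : W →ₗ⋆[ℂ] W}

/-- `f ↦ σ ∘ f ∘ J` preserves `G`-equivariance when `σ` and `J` are `G`-invariant. [folklore] -/
def conjTwistHom (hσ : IsRealStructure ρ σ) (hJ : IsQuaternionicStructure π J)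
    (f : IntertwiningMap π ρ) : IntertwiningMap π ρ :=
  LinearMap.intertwiningMap_of_isIntertwiningMap π ρ (conjTwistLinear σ J f.toLinearMap)
    fun g w => by
      rw [conjTwistLinear_apply, conjTwistLinear_apply, hJ.2 g w, ← hσ.2 g]
      congr 1
      exact congrFun (congrArg DFunLike.coe (f.isIntertwining' g)) (J w)

/-- Unfolding lemma for `conjTwistHom`. [folklore] -/
@[simp] private theorem conjTwistHom_apply (hσ : IsRealStructure ρ σ)
    (hJ : IsQuaternionicStructure π J) (f : IntertwiningMap π ρ) (w : W) :
    conjTwistHom hσ hJ f w = σ (f (J w)) := rfl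

/-- The antilinear operator `Φ : f ↦ σ ∘ f ∘ J` on `Hom_G(W, E)`. [folklore] -/
def conjTwistₛₗ (hσ : IsRealStructure ρ σ) (hJ : IsQuaternionicStructure π J) :
    IntertwiningMap π ρ →ₗ⋆[ℂ] IntertwiningMap π ρ where
  toFun := conjTwistHom hσ hJ
  map_add' f₁ f₂ := by
    apply IntertwiningMap.ext
    ext w
    change σ ((f₁ + f₂) (J w)) = σ (f₁ (J w)) + σ (f₂ (J w))
    rw [IntertwiningMap.coe_add, Pi.add_apply, map_add]
  map_smul' c f := by
    apply IntertwiningMap.ext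
    ext w
    change σ ((c • f) (J w)) = (starRingEnd ℂ) c • σ (f (J w))
    rw [IntertwiningMap.coe_smul, Pi.smul_apply, LinearMap.map_smulₛₗ]

/-- `Φ ∘ Φ = −id` on `Hom_G(W, E)`: `σσ f JJ = f ∘ (−id) = −f`. [folklore] -/
private theorem conjTwistₛₗ_conjTwistₛₗ (hσ : IsRealStructure ρ σ) (hJ : IsQuaternionicStructure π J)
    (f : IntertwiningMap π ρ) :
    conjTwistₛₗ hσ hJ (conjTwistₛₗ hσ hJ f) = -f := by
  apply IntertwiningMap.ext
  ext w
  change σ (σ (f (J (J w)))) = (-f) w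
  rw [hσ.1, hJ.1, map_neg, IntertwiningMap.coe_neg, Pi.neg_apply]

/-- **Frobenius–Schur parity (the mechanism of Deninger's Theorem 2.13).**  Let `G` be any monoid,
`(E, ρ)` a finite-dimensional complex `G`-module with a `G`-invariant real structure `σ`, and
`(W, π)` a finite-dimensional complex `G`-module with a `G`-invariant quaternionic structure `J`.
Then `dim_ℂ Hom_G(W, E)` is **even**: `f ↦ σ ∘ f ∘ J` is a quaternionic structure on
`Hom_G(W, E)`.  This is the step "a symplectic irreducible occurs with even multiplicity in the
complexification of a real `G`-module" of the printed proof (there via [S1]).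
[cite: Deninger2022, §2, proof of Thm. 2.13] -/
theorem finrank_intertwiningMap_even [FiniteDimensional ℂ W] [FiniteDimensional ℂ E]
    (hσ : IsRealStructure ρ σ) (hJ : IsQuaternionicStructure π J) :
    Even (finrank ℂ (IntertwiningMap π ρ)) :=
  finrank_even_of_quaternionicStructure (conjTwistₛₗ hσ hJ) (conjTwistₛₗ_conjTwistₛₗ hσ hJ)

end Intertwining

/-! ## §3. Generalized eigenspaces of `θ` at real `α` inherit the real structure -/

section Eigenspace

variable {E : Type w} [AddCommGroup E] [Module ℂ E]

/-- One step: for real `α`, `(θ − α)(σ x) = σ((θ − α) x)` when the antilinear `σ` commutes with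
`θ` (uses `conj α = α`). [folklore] -/
private theorem sub_real_smul_one_apply_comm (θ : Module.End ℂ E) (σ : E →ₗ⋆[ℂ] E)
    (hθσ : ∀ x, σ (θ x) = θ (σ x)) (α : ℝ) (x : E) :
    (θ - (α : ℂ) • (1 : Module.End ℂ E)) (σ x) = σ ((θ - (α : ℂ) • (1 : Module.End ℂ E)) x) := by
  rw [LinearMap.sub_apply, LinearMap.sub_apply, LinearMap.smul_apply, LinearMap.smul_apply,
    Module.End.one_apply, Module.End.one_apply, map_sub, hθσ, LinearMap.map_smulₛₗ,
    Complex.conj_ofReal]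

/-- If `σ` is antilinear and commutes with the linear `θ`, then for **real** `α` and every `k`,
`(θ − α)^k ∘ σ = σ ∘ (θ − α)^k`. [folklore] -/
private theorem pow_sub_real_smul_one_apply_comm (θ : Module.End ℂ E) (σ : E →ₗ⋆[ℂ] E)
    (hθσ : ∀ x, σ (θ x) = θ (σ x)) (α : ℝ) (k : ℕ) (x : E) :
    ((θ - (α : ℂ) • (1 : Module.End ℂ E)) ^ k) (σ x) =
      σ (((θ - (α : ℂ) • (1 : Module.End ℂ E)) ^ k) x) := by
  induction k generalizing x with
  | zero => simp
  | succ k ih =>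
    rw [pow_succ, Module.End.mul_apply, Module.End.mul_apply,
      sub_real_smul_one_apply_comm θ σ hθσ α x, ih]

/-- **The `1/2`-part inherits the real structure.**  If `σ` is an antilinear map commuting with
`θ`, then for real `α` the generalized eigenspace `E^{θ∼α} = ⋃_k ker (θ − α)^k`
(`Module.End.maxGenEigenspace`) is `σ`-stable.  In the proof of Thm. 2.13 this is the sentence
"`V_k^ℝ = H¹(Spec ō_k, ℛ)^{θ∼1/2}` would be a `G`-module with `V_k = V_k^ℝ ⊗_ℝ ℂ`": the real
structure `id ⊗ conj` of `H¹(ℛ) ⊗ ℂ` commutes with `θ = θ_ℝ ⊗ id` and `1/2` is real.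
[cite: Deninger2022, §2, proof of Thm. 2.13] -/
theorem maxGenEigenspace_realStructure_stable (θ : Module.End ℂ E) (σ : E →ₗ⋆[ℂ] E)
    (hθσ : ∀ x, σ (θ x) = θ (σ x)) (α : ℝ) {x : E}
    (hx : x ∈ θ.maxGenEigenspace (α : ℂ)) : σ x ∈ θ.maxGenEigenspace (α : ℂ) := by
  rw [Module.End.mem_maxGenEigenspace] at hx ⊢
  obtain ⟨k, hk⟩ := hx
  exact ⟨k, by rw [pow_sub_real_smul_one_apply_comm θ σ hθσ α k x, hk, map_zero]⟩

end Eigenspace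

/-! ## §4. Arithmetic vocabulary: finite Galois quotients of `Γ_ℚ`, inflation, order at `1/2` -/

section Arithmetic

variable {G : Type u} [Group G]

/-- The complex `G`-module `V_π = ℂⁿ` (column vectors) of a matrix representation
`π : G →* GL_n(ℂ)` (`Literature.NumberTheory.GaloisRepresentations.glStdRepresentation`
composed with `π`). [folklore] -/
abbrev matrixRep {n : ℕ} (π : G →* GL (Fin n) ℂ) : Representation ℂ G (Fin n → ℂ) :=
  (glStdRepresentation (Fin n) ℂ).comp π

variable [TopologicalSpace G] [DiscreteTopology G]

/-- **A finite Galois extension `k/ℚ` presented by its group**: `G = Gal(k/ℚ)` (finite, discrete)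
together with the restriction map `r = r_k : Γ_ℚ = Gal(ℚ̄/ℚ) → G`, a continuous surjection (its
kernel `Gal(ℚ̄/k)` is open).  By infinite Galois theory these data are exactly the finite Galois
extensions of `ℚ` inside `ℚ̄` (`k = ℚ̄^{ker r}`; cf. the tree's
`Literature.NumberTheory.GaloisRepresentations.absRestrictNormalHom`,
`isOpen_ker_absRestrictNormalHom`, `absRestrictNormalHom_surjective`, and conversely
`exists_isGalois_restrictNormalHom_ker_eq`); the group-theoretic presentation keeps Deninger's
`G`-modules (`G` acting on `H¹(Spec ō_k, 𝒞)` "by contravariant functoriality") in Mathlib's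
`Representation` language. [cite: Deninger2022, §2, paragraph before (2.10)] -/
structure IsFiniteGaloisQuotient (r : Field.absoluteGaloisGroup ℚ →ₜ* G) : Prop where
  finite : Finite G
  surjective : Function.Surjective r

/-- **Inflation** of a matrix representation `π : G →* GL_n(ℂ)` of a finite Galois quotient
`r : Γ_ℚ → G = Gal(k/ℚ)` to the framed Artin representation `π ∘ r : Γ_ℚ →ₜ* GL_n(ℂ)` of `ℚ`
(cf. `Literature.NumberTheory.GaloisRepresentations.inflateCharacter`).  Deninger's `L(V_π, s)`
is the Artin L-function of this representation of `Gal(ℚ̄/ℚ)`.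
[cite: Deninger2022, §2, (2.10)] -/
def inflate (r : Field.absoluteGaloisGroup ℚ →ₜ* G) {n : ℕ} (π : G →* GL (Fin n) ℂ) :
    FramedArtinRep ℚ n :=
  ⟨π.comp r.toMonoidHom, (continuous_of_discreteTopology (f := ⇑π)).comp (map_continuous r)⟩

/-- Unfolding lemma for `inflate`. [folklore] -/
private theorem inflate_apply (r : Field.absoluteGaloisGroup ℚ →ₜ* G) {n : ℕ} (π : G →* GL (Fin n) ℂ)
    (γ : Field.absoluteGaloisGroup ℚ) : inflate r π γ = π (r γ) := rfl

/-- `g` **is a meromorphic continuation of `L(V_π, s)`**: `g` is meromorphic on `ℂ` and agrees on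
`re s > 1` with the Euler product `Literature.NumberTheory.GaloisRepresentations.artinLFunction`
of the inflated representation (cf. `LFunction.HasMeromorphicContinuation`; such `g` exist by
Brauer's theorem, `Literature.NumberTheory.Automorphic.artin_brauer_hasMeromorphicContinuation`).
[cite: Deninger2022, §2, (2.10)–(2.11)] -/
def IsArtinContinuation (r : Field.absoluteGaloisGroup ℚ →ₜ* G) {n : ℕ} (π : G →* GL (Fin n) ℂ)
    (g : ℂ → ℂ) : Prop :=
  Meromorphic g ∧ ∀ s : ℂ, 1 < s.re → g s = artinLFunction (inflate r π).toArtinRep s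

/-- **`ord_{s=1/2} L(V_π, s)` is odd**, rendered continuation-free: every meromorphic continuation
of `L(V_π, s)` has an odd (natural-number) order at `s = 1/2` (all continuations have the same
order there by the identity principle, so "every" costs nothing).  In the printed proof this holds
for an irreducible symplectic `π` with root number `W(π) = −1`: "From the functional equation of
`L(V_π, s)` it follows that `ord_{s=1/2} L(V_π, s) ≥ 1` is odd."
[cite: Deninger2022, §2, proof of Thm. 2.13] -/
def HasOddCentralOrder (r : Field.absoluteGaloisGroup ℚ →ₜ* G) {n : ℕ} (π : G →* GL (Fin n) ℂ) :
    Prop :=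
  ∀ g : ℂ → ℂ, IsArtinContinuation r π g →
    ∃ m : ℕ, Odd m ∧ meromorphicOrderAt g (1 / 2) = (m : WithTop ℤ)

/-- **Identity principle: the order at a point does not depend on the continuation.**  Two functions
meromorphic on `ℂ` that agree on the half-plane `re s > 1` agree on a punctured neighbourhood of
every point, hence have the same `meromorphicOrderAt` everywhere (isolated zeros of `g₁ − g₂` on
the connected `ℂ`).  So "`ord_{s=1/2} L(V_π, s)`" read off *some* continuation
(`SatisfiesCentralMultiplicity`, `∃ g`) and off *every* continuation (`HasOddCentralOrder`, `∀ g`)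
is the same number. [folklore] -/
private theorem meromorphicOrderAt_eq_of_eqOn_halfPlane {g₁ g₂ : ℂ → ℂ} (hg₁ : Meromorphic g₁)
    (hg₂ : Meromorphic g₂) (h : ∀ s : ℂ, 1 < s.re → g₁ s = g₂ s) (z : ℂ) :
    meromorphicOrderAt g₁ z = meromorphicOrderAt g₂ z := by
  have hsub : Meromorphic (g₁ - g₂) := hg₁.sub hg₂
  -- `g₁ - g₂` vanishes identically near `s = 2`
  have h2 : meromorphicOrderAt (g₁ - g₂) 2 = ⊤ := by
    rw [meromorphicOrderAt_eq_top_iff]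
    have hopen : IsOpen {s : ℂ | 1 < s.re} := isOpen_lt continuous_const Complex.continuous_re
    have hmem : (2 : ℂ) ∈ {s : ℂ | 1 < s.re} := by simp
    filter_upwards [nhdsWithin_le_nhds (hopen.mem_nhds hmem)] with s hs
    simp [Pi.sub_apply, h s hs]
  -- hence it vanishes identically near every point (`ℂ` is connected)
  have hall : ∀ w : ℂ, meromorphicOrderAt (g₁ - g₂) w = ⊤ := by
    by_contra hcon
    push Not at hcon
    obtain ⟨w, hw⟩ := hcon
    have := ((hsub.meromorphicOn (s := Set.univ)).exists_meromorphicOrderAt_ne_top_iff_forall_mem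
      isConnected_univ).1 ⟨w, Set.mem_univ w, hw⟩ 2 (Set.mem_univ 2)
    exact this h2
  refine meromorphicOrderAt_congr ?_
  filter_upwards [meromorphicOrderAt_eq_top_iff.1 (hall z)] with s hs
  simpa [sub_eq_zero] using hs

/-- **`ord_{s=α} L(V_π, s)` is well defined**: any two meromorphic continuations of `L(V_π, s)`
have the same order at every point (identity principle on the connected `ℂ`), so "the non-trivial
zeroes of the Artin L-function `L(V_π, s)` counted with multiplicity" in (2.10)–(2.11) does not
depend on the continuation chosen. [cite: Deninger2022, §2, (2.10)–(2.11)] -/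
theorem IsArtinContinuation.meromorphicOrderAt_eq {r : Field.absoluteGaloisGroup ℚ →ₜ* G} {n : ℕ} {π : G →* GL (Fin n) ℂ} {g₁ g₂ : ℂ → ℂ}
    (h₁ : IsArtinContinuation r π g₁) (h₂ : IsArtinContinuation r π g₂) (z : ℂ) :
    meromorphicOrderAt g₁ z = meromorphicOrderAt g₂ z :=
  meromorphicOrderAt_eq_of_eqOn_halfPlane h₁.1 h₂.1 (fun s hs => by rw [h₁.2 s hs, h₂.2 s hs]) z

/-- The `∀ g` rendering `HasOddCentralOrder` of "`ord_{s=1/2} L(V_π, s)` is odd" is no stronger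
than the `∃ g` rendering: one continuation with odd order at `1/2` suffices
(`IsArtinContinuation.meromorphicOrderAt_eq`). [cite: Deninger2022, §2, proof of Thm. 2.13] -/
theorem hasOddCentralOrder_of_exists {r : Field.absoluteGaloisGroup ℚ →ₜ* G} {n : ℕ}
    {π : G →* GL (Fin n) ℂ}
    (h : ∃ g : ℂ → ℂ, IsArtinContinuation r π g ∧
      ∃ m : ℕ, Odd m ∧ meromorphicOrderAt g (1 / 2) = (m : WithTop ℤ)) :
    HasOddCentralOrder r π := by
  obtain ⟨g, hg, m, hm, hgm⟩ := h
  intro g' hg'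
  exact ⟨m, hm, by rw [hg'.meromorphicOrderAt_eq hg (1 / 2), hgm]⟩

/-! ## §5. Property (2.12), the proved reduction, and the barrier -/

/-- **Deninger's property (2.12)** for a finite-dimensional complex `G = Gal(k/ℚ)`-module `(E, ρ)`
in the role of `V_k = H¹(Spec ō_k, 𝒞)^{θ∼1/2}` (`r : Γ_ℚ → G` the restriction): for every
irreducible complex representation `π` of `G` (here `π : G →* GL_n(ℂ)` with `V_π = ℂⁿ`
irreducible), `dim_ℂ Hom_G(V_π, E) = ord_{s=1/2} L(V_π, s)`, the right-hand side read off a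
meromorphic continuation `g` of the Artin L-function (`IsArtinContinuation`; `∃ g` — any two
agree near `1/2`). [cite: Deninger2022, §2, (2.12)] -/
def SatisfiesCentralMultiplicity (r : Field.absoluteGaloisGroup ℚ →ₜ* G) {E : Type}
    [AddCommGroup E] [Module ℂ E] [FiniteDimensional ℂ E] (ρ : Representation ℂ G E) : Prop :=
  ∀ (n : ℕ) (π : G →* GL (Fin n) ℂ), (matrixRep π).IsIrreducible →
    ∃ g : ℂ → ℂ, IsArtinContinuation r π g ∧
      meromorphicOrderAt g (1 / 2) = (finrank ℂ (IntertwiningMap (matrixRep π) ρ) : WithTop ℤ)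

/-- **The reduction (the printed proof of Theorem 2.13, with its arithmetic input as hypothesis).**
If `G = Gal(k/ℚ)` has an irreducible representation `π` of quaternionic (symplectic) type whose
Artin L-function has odd order at `s = 1/2`, then **no** finite-dimensional complex `G`-module
with a `G`-invariant real structure satisfies (2.12): by (2.12) the multiplicity `dim Hom_G(V_π, E)`
would be that odd order, but it is even by Frobenius–Schur parity
(`finrank_intertwiningMap_even`).  Proved; no arithmetic is used.
[cite: Deninger2022, §2, Thm. 2.13 (proof)] -/
theorem not_satisfiesCentralMultiplicity_of_oddCentralOrder
    {r : Field.absoluteGaloisGroup ℚ →ₜ* G} {n : ℕ} {π : G →* GL (Fin n) ℂ}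
    (hirr : (matrixRep π).IsIrreducible) {J : (Fin n → ℂ) →ₗ⋆[ℂ] (Fin n → ℂ)}
    (hJ : IsQuaternionicStructure (matrixRep π) J) (hodd : HasOddCentralOrder r π) {E : Type}
    [AddCommGroup E] [Module ℂ E] [FiniteDimensional ℂ E] {ρ : Representation ℂ G E}
    {σ : E →ₗ⋆[ℂ] E} (hσ : IsRealStructure ρ σ) : ¬ SatisfiesCentralMultiplicity r ρ := by
  intro h
  obtain ⟨g, hg, hord⟩ := h n π hirr
  obtain ⟨m, hm, hgm⟩ := hodd g hg
  have heven : Even (finrank ℂ (IntertwiningMap (matrixRep π) ρ)) :=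
    finrank_intertwiningMap_even hσ hJ
  rw [hgm] at hord
  have hmeq : m = finrank ℂ (IntertwiningMap (matrixRep π) ρ) := by exact_mod_cast hord
  exact (Nat.not_even_iff_odd.mpr hm) (hmeq ▸ heven)

/-- **Barrier `NoRealWeilCohomology` — Deninger 2022, Theorem 2.13 (named fact).**  "For a number
field `k` there is no functorial real valued cohomology theory `H•(Spec ō_k, ℛ)` with endomorphism
`θ_ℝ` such that `H•(Spec ō_k, 𝒞) := H•(Spec ō_k, ℛ) ⊗_ℝ ℂ` with `θ := θ_ℝ ⊗ id` satisfies property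
(2.12)."  Vendored in the form the printed proof establishes: **there is a finite Galois extension
`k/ℚ` — presented by its group `G = Gal(k/ℚ)` and the restriction `r : Γ_ℚ ↠ G`
(`IsFiniteGaloisQuotient`) — over which no finite-dimensional complex `G`-module `E` carrying a
`G`-invariant real structure `σ` satisfies (2.12)** (`SatisfiesCentralMultiplicity`).  A functorial
real theory would give exactly such an `(E, σ) = (H¹(Spec ō_k, ℛ)^{θ_ℝ∼1/2} ⊗ ℂ, id ⊗ conj)`
over every `k` (`maxGenEigenspace_realStructure_stable`; corollary `noFunctorialRealTheory`).
The printed proof = `not_satisfiesCentralMultiplicity_of_oddCentralOrder` (proved here) applied to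
a quaternion (`H₈`) field `k` with `W(π) = −1` for its 2-dimensional symplectic `π`
([cite: Omar2001], [cite: Frohlich1972]), where the functional equation makes
`ord_{s=1/2} L(V_π, s)` odd
(`Deninger2022_noRealWeilCohomology_of_witness` isolates this input); that arithmetic input is the
only unformalised step (D-0014 named fact).

BARRIER (structured block, D-0021):
- technique_class: Weil-cohomology-for-Spec-Z real-coefficients functorial-cohomology-with-theta Hilbert-Polya-real-structure Galois-equivariant-multiplicity ord-L-at-one-half; formally: finite-dimensional complex `Gal(k/ℚ)`-modules `(E, ρ)` with a `Gal(k/ℚ)`-invariant real structure `σ` (`IsRealStructure`) asked to satisfy (2.12) `dim_ℂ Hom_G(V_π, E) = ord_{s=1/2} L(V_π, s)` for all irreducible `π` (`SatisfiesCentralMultiplicity`) [cite: Deninger2022, §2, (2.12), Thm. 2.13]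
- blocks: any real-valued (co)homological / spectral realisation of the zeros of `ζ_k` that is functorial in `k` (so `Gal(k/ℚ)`-equivariant) and assigns to each Artin L-factor its order of vanishing at `1/2` as a multiplicity — Deninger's own hoped-for `H•(Spec ō_k, ℛ)` with real coefficients [cite: Deninger2022, §2, Thm. 2.13], and the untwisted leafwise cohomology of foliated dynamical systems for `Spec ō_k` ("Complex leafwise cohomology always has the real structure given by the cohomology of the real forms … it follows that the analogy is too simple. There has to be a twisted version of leafwise cohomology with complex coefficients that does not have a natural real structure") [cite: Deninger2022, §2, after Thm. 2.13]
- because: a symplectic (quaternionic-type) irreducible `π` of `Gal(k/ℚ)` occurs with EVEN multiplicity in any complex `Gal(k/ℚ)`-module with invariant real structure (Frobenius–Schur / [S1]; proved here: `finrank_intertwiningMap_even`), whereas for quaternion fields with root number `W(π) = −1` the functional equation forces `ord_{s=1/2} L(V_π, s)` to be ODD [cite: Deninger2022, §2, proof of Thm. 2.13] [cite: Frohlich1972]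
- evasions_known: complex coefficients without real structure (the `𝒞`-valued theory of [D2], [D3] is untouched); a QUATERNIONIC structure `∗`, `∗² = −1`, i.e. a theory with values in Kottwitz's category `K_ℝ` ("a 'Weil-'cohomology theory with values in `K_ℝ` is a possibility for arithmetic curves") [cite: Deninger2022, §2, (2.7) and the paragraph after Thm. 2.13]; dropping functoriality in `k` / Galois equivariance (a construction for `ζ` alone over `ℚ`, `G = 1`, is not constrained: (2.12) then only says `dim V_ℚ = ord_{1/2} ζ(s) = 0`) [cite: Deninger2022, §2, (2.8)]
- status: established (Theorem 2.13 of a refereed paper; the representation-theoretic mechanism is machine-checked in this file; the arithmetic input — quaternion fields with `W(π) = −1` and the functional equation — is classical [cite: Frohlich1972] [cite: Omar2001])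
- scope_caveats: (i) only theories with a `Gal(k/ℚ)`-invariant REAL structure on the `1/2`-part and property (2.12) for ALL irreducible `π` are excluded — nothing is said about complex or quaternionic coefficients, nor about a theory for a single field without functoriality [cite: Deninger2022, §2]; (ii) the obstruction lives at number fields `k` whose Galois group has a symplectic `π` with `W(π) = −1` (e.g. suitable `H₈`-extensions); over `k = ℚ` alone it is void [cite: Deninger2022, §2, proof of Thm. 2.13]; (iii) only the functional equation is used, not RH, and the function-field analogue of (2.10) is TRUE [cite: Deninger2022, §2, "c.f. [FQ]"]; (iv) in this file `ord_{s=1/2}` is read off meromorphic continuations of the tree's Euler product `artinLFunction` (all Euler factors, Neukirch VII (10.1)), a finite Galois `k/ℚ` is presented as a continuous finite quotient `r : Γ_ℚ ↠ G` (infinite Galois theory), and the existence of the witness field is the content of the named fact, not formalised (`Deninger2022_noRealWeilCohomology_of_witness` states exactly what would discharge it).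

[cite: Deninger2022, §2, Thm. 2.13] -/
def Deninger2022_noRealWeilCohomology : Prop :=
  ∃ (G : Type) (_ : Group G) (_ : TopologicalSpace G) (_ : DiscreteTopology G)
    (r : Field.absoluteGaloisGroup ℚ →ₜ* G), IsFiniteGaloisQuotient r ∧
    ∀ (E : Type) [AddCommGroup E] [Module ℂ E] [FiniteDimensional ℂ E]
      (ρ : Representation ℂ G E) (σ : E →ₗ⋆[ℂ] E),
      IsRealStructure ρ σ → ¬ SatisfiesCentralMultiplicity r ρ

omit [TopologicalSpace G] [DiscreteTopology G] in
/-- **What discharges the named fact** (the arithmetic input of the printed proof, isolated): a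
finite Galois quotient `G = Gal(k/ℚ)` of `Γ_ℚ` having an irreducible representation of
quaternionic type with odd central order of its Artin L-function — in print: an `H₈`-field with
root number `W(π) = −1` for the 2-dimensional symplectic `π` (Deninger's [O] =
[cite: Omar2001]; [cite: Frohlich1972]) together with the functional equation.  Proved from
`not_satisfiesCentralMultiplicity_of_oddCentralOrder`.
[cite: Deninger2022, §2, proof of Thm. 2.13] -/
theorem Deninger2022_noRealWeilCohomology_of_witness {G : Type} [Group G] [TopologicalSpace G]
    [DiscreteTopology G] {r : Field.absoluteGaloisGroup ℚ →ₜ* G} (hr : IsFiniteGaloisQuotient r)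
    {n : ℕ} {π : G →* GL (Fin n) ℂ} (hirr : (matrixRep π).IsIrreducible)
    {J : (Fin n → ℂ) →ₗ⋆[ℂ] (Fin n → ℂ)} (hJ : IsQuaternionicStructure (matrixRep π) J)
    (hodd : HasOddCentralOrder r π) : Deninger2022_noRealWeilCohomology :=
  ⟨G, ‹_›, ‹_›, ‹_›, r, hr, fun _ _ _ _ _ _ hσ =>
    not_satisfiesCentralMultiplicity_of_oddCentralOrder hirr hJ hodd hσ⟩

omit [Group G] [TopologicalSpace G] [DiscreteTopology G] in
/-- **The functorial formulation of Theorem 2.13.**  Granting the named fact: it is impossible to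
attach to *every* finite Galois `k/ℚ` (every finite Galois quotient `Γ_ℚ ↠ G`) a
finite-dimensional complex `G`-module with an invariant real structure satisfying (2.12) — in
particular no functor `k ↦ (H•(Spec ō_k, ℛ), θ_ℝ)` as in the theorem exists, since its `1/2`-parts
`H¹(Spec ō_k, ℛ)^{θ_ℝ∼1/2} ⊗_ℝ ℂ` would be such modules.
[cite: Deninger2022, §2, Thm. 2.13] -/
theorem noFunctorialRealTheory (h : Deninger2022_noRealWeilCohomology) :
    ¬ ∀ (G : Type) [Group G] [TopologicalSpace G] [DiscreteTopology G]
        (r : Field.absoluteGaloisGroup ℚ →ₜ* G), IsFiniteGaloisQuotient r →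
        ∃ (E : Type) (_ : AddCommGroup E) (_ : Module ℂ E) (_ : FiniteDimensional ℂ E)
          (ρ : Representation ℂ G E) (σ : E →ₗ⋆[ℂ] E),
          IsRealStructure ρ σ ∧ SatisfiesCentralMultiplicity r ρ := by
  obtain ⟨G, _, _, _, r, hr, hG⟩ := h
  intro H
  obtain ⟨E, _, _, _, ρ, σ, hσ, hsat⟩ := H G r hr
  exact hG E ρ σ hσ hsat

end Arithmetic

end Literature.Barriers.RiemannHypothesis
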